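import Mathlib
import HarnessLib
import HarnessLib.Audit
import Summits.ABC.Statement
import Summits.ABC.ABC.Theorems.PlacewiseSzpiroPayoff
import HarnessLib.Audit.Status.Attr

/-!
Route: GaussianTwoDivision

# Route GaussianTwoDivision — Szpiro exponent 2/3 on the Gaussian two-division class via the Z[i]
unit-equation dictionary

D-0145 ideator LINE (abc-idea-1 g2, technique card «dictionary import with an explicit checkable
dictionary»). NO SUMMIT IS PROVED BY A LINE; typed ≠ proved; this is NOT abc and NOT A-PS. It
suffices to show X = X_class ∧ X_res, where X_class = `GaussianClassEpsShape`: Szpiro's inequality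
in ε-shape with exponent 2/3, `log|Δ_min(E)| ≤ C(ε)·N_E^(2/3+ε)`, for every curve in the GAUSSIAN
TWO-DIVISION CLASS `E = W_{a,b} : y² = x(x² + a x + b)`, `gcd(a,b) = 1`, `4b − a² = m² ≠ 0` (a
rational 2-torsion point at (0,0), two-division field ℚ(i), semistable away from 2) — the record for
all E/ℚ being α = 1 (Murty–Pasten `log|Δ| ≪ N log N`) and α = 1/3 being known only on the
Frey–Hellegouarch class (full rational 2-torsion, Stewart–Yu); and X_res = `GaussianResidual`, abc
off this class, a DECLARED RESIDUAL of summit strength that this line does NOT claim (booked so the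
class theorem has a home; to be narrowed to the rung `SzpiroExponentBelowOne` off the class once
that rung is a registered closer). X_class itself reduces, by the explicit dictionary, to ONE
ℤ-statement, the crux `GaussianNormTripleBound`: for coprime a, b and m ≠ 0 with a² + m² = 4b, `log
b ≤ κ(ε)·rad(b·m)^(2/3+ε)` — an abc-type bound for the triple (a², m², 4b) in which rad(a) does NOT
appear.
Lean: `Summit.ABC.ABC.Theses.GaussianTwoDivision.GaussianClassEpsShape ∧
Summit.ABC.ABC.Theses.GaussianTwoDivision.GaussianResidual`

## Assembly
Pure logic: `closes (h₁ : GaussianNormTripleBound) (h₂ : TwoTorsionDictionary) (h₃ : GaussianPayoff)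
(h₄ : GaussianResidual) : _root_.ABC := h₄ (h₃ h₁ h₂)` (glue1.lean). The mathematical content of the
line is h₃ h₁ h₂ : GaussianClassEpsShape; h₄ is the declared residual.

Rationale: WHY THIS LINE. DICTIONARY (explicit, checkable): E = W_{a,b} ↦ the three-term unit equation u₁ + u₂
+ u₃ = 0 in ℤ[i] with u₁ = e₊ − e₋ = m·i, u₂ = e₋, u₃ = −e₊, where e_± = (−a ± m i)/2 ∈ ℤ[i] are the
non-zero 2-torsion abscissae (a ≡ m mod 2 is forced by a² + m² = 4b); e₊e₋ = b, so the prime support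
of u₁u₂u₃ is that of b·m only — the coefficient a, which carries the primes of GOOD reduction, is
absorbed — and Δ(W_{a,b}) = 16 b²(a² − 4b) = −16 b² m² = 16 (u₁u₂u₃)² (kernel-checked identity in
Sketch1.lean), pairwise coprimality of (u₁,u₂,u₃) follows from gcd(a,b) = 1, and G_{ℚ(i)}(u) ≤
2·rad(bm)². IMPORT (transcendence / unit equations over number fields): Scoones, arXiv:2111.07791,
Thm 3 and its corollary `log H_L(a,b,c) < G^(1/3 + C₁₁ logloglog G/loglog G)` with constants
depending on K only and G the radical over the Hilbert class field L of K [corpus: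
paper-arxiv-2111.07791 p.4]; for K = ℚ(i) the class number is 1, L = K, so the corollary applies
verbatim and gives `GaussianNormTripleBound` with exponent 2·(1/3) = 2/3 (split primes of b are
counted twice in G). Engines behind it: Yu 2007 p-adic logarithmic forms over number fields and
Matveev 2000 (tree rungs F-A1.M3, A1.L over ℚ only). WHAT IT DOES THAT PRIOR ROUTES DO NOT: the
Baker-class routes of cell abc-stewartyu (PadicPrimesW80TwoThirds, PadicPrimesKummerThird,
YuMatveevShapeRat, PadicPrincipalCore*) treat abc triples over ℚ, i.e. the Frey class with FULL
rational 2-torsion; CubicResolventAllowance (abc-idea-2) uses the 2-division field at A-PS strength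
through index windows; this line is the first on the ladder to move the Szpiro exponent below the
all-E record on a class with ONE rational 2-torsion point, by running the number-field Stewart–Yu
machine over the FIXED two-division field ℚ(i). Nearest print: Cuevas Barrientos–Pasten
arXiv:2504.15971 Cor 1.2 (subexponential Szpiro in ONE-parameter families, modular method + LFL) and
Pasten arXiv:2312.03566 (n² + 1, the one-parameter slice m = 2 of this class); the Gaussian class is
two-parameter (a, m) and Zariski-dense in the 2-torsion locus, not a union of finitely many pencils.

RANKED CRUXES. #0 GaussianClassEpsShape (target) — Szpiro ε-shape with exponent 2/3 on the Gaussian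
two-division class: for every ε > 0 there is C with log|Δ_min(W)| ≤ C·N_W^(2/3+ε) for every elliptic
W = ⟨0,a,0,b,0⟩ with gcd(a,b) = 1 and a² + m² = 4b, m ≠ 0. (why it might fail: only through the crux
below; the class could also be too thin to be interesting (it is infinite and two-parameter: any
coprime a ≡ m (mod 2), b = (a²+m²)/4).) [arXiv:2111.07791, StewartYu2001, MurtyPasten2013]
#2 GaussianNormTripleBound (crux) — GAUSSIAN NORM-FORM TRIPLE BOUND (ℤ-shadow of Stewart–Yu over
ℚ(i)): for every ε > 0 there are κ, c₀ such that for all integers a, b, m with gcd(a,b) = 1, m ≠ 0,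
a² + m² = 4b and b ≥ c₀: log b ≤ κ·rad(b·m)^(2/3+ε). The radical of a does not appear. [difficulty:
L] (why it might fail: Scoones' G^(1/3+o(1)) corollary is printed over the Hilbert class field with
her relabeling (2) and unit normalisation; if for K = ℚ(i) the triple (mi, e₋, −e₊) violates a side
condition, or G counts split primes beyond rad(bm)², the exponent 2/3 degrades (to ≤ 1, not to
nothing).) [arXiv:2111.07791, StewartYu2001, EvertseGyory2015, doi:10.4064/aa123-1-2]
#3 GaussianResidual (crux) — DECLARED RESIDUAL (summit-strength, NOT claimed, exempt from T3/T4):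
abc given the class theorem — i.e. abc off the Gaussian two-division class. Booked so that `closes`
reaches the Statement decl; to be narrowed to `SzpiroExponentBelowOne` off the class when that rung
is a registered closer. [deps: GaussianClassEpsShape] [difficulty: open-problem] (why it might fail:
it is abc itself outside a thin class — open; no claim; kept only as the honest complement of the
conjunct this line attacks.) [Oesterle1988, MurtyPasten2013]
#9 TwoTorsionDictionary (support) — TWO-TORSION DICTIONARY (Tate's algorithm away from 2): for
coprime a, b with b(a² − 4b) ≠ 0 and W = ⟨0,a,0,b,0⟩ elliptic, |Δ_min(W)| ≤ |16 b²(a² − 4b)| and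
rad(b(a² − 4b)) divides 2·N_W (every odd prime of b(a² − 4b) is multiplicative: the model is minimal
there since p ∤ c₄ = 16(a² − 3b), and the reduction is a node). [difficulty: M] [Silverman2009,
BennettSkinner2004]
#9 GaussianPayoff (support) — PAYOFF GLUE: the triple bound and the dictionary give the class
ε-shape (log|16 b² m²| ≤ log 64 + 3 log b since m² ≤ 4b; rad(bm) ≤ 2N; finitely many b < c₀ absorbed
into C). [difficulty: provable-now] [Silverman2009]

TWO-LAYER PLAN. GaussianNormTripleBound ⇐ GaussianUnitEquationBound → GaussianDictionaryLemma →
GaussianNormTripleBound, where GaussianUnitEquationBound = Stewart–Yu–Scoones over ℤ[i] in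
coordinates (`∀ ε>0 ∃ κ c₀, ∀ u v w : GaussianInt, u+v+w = 0 → IsCoprime u v → u*v*w ≠ 0 → c₀ ≤ max
|N u_i| → log max|N u_i| ≤ κ·rad(N(uvw))^(2/3+ε)`, typed in bc/GaussianNormTripleBound_birth.lean)
and GaussianDictionaryLemma = the elementary step (a,m,b) ↦ (mi, e₋, −e₊) (a ≡ m mod 2, pairwise
coprimality, N(u₁u₂u₃) = m²b²). EXTENSIONS foreseen (not filed): (E1) the same line for each
class-number-one quadratic two-division field ℚ(√d) (real d: units enter through the regulator,
constants still depend on d only); (E2) exponent 2/3 → 1/3 + (share of inert/ramified primes) by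
re-running Stewart–Yu's prime sorting with split primes counted once; (E3) d-UNIFORMITY is blocked —
see Barriers (B-LFL×DIVFIELD).

KILL CRITERIA. A refutation of GaussianNormTripleBound (a family a² + m² = 4b with log b /
rad(bm)^(2/3+ε) unbounded) closes the route (close --reason refuted:GaussianNormTripleBound) and
would itself be a theorem of record against Stewart–Yu over ℚ(i); a refutation of
TwoTorsionDictionary as typed forces a restatement (p = 2 bookkeeping), not a pivot. If
SzpiroEpsShape (2/3) is proved for all E elsewhere the route is moot (superseded).

NOT DECOMPOSED YET. The Scoones engine as a Literature named fact over number fields (heights H_L,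
radical over O_L) is not typed here — the crux is its ℤ-shadow for the one field ℚ(i); the general
class-number-one version (E1), the exponent refinement (E2) and any d-uniform statement are
deliberately not filed (E3 is a barrier, below).

CHEAPEST FALSIFIER. Enumerate coprime (a, m) with a ≡ m (mod 2), b = (a² + m²)/4 ≤ 10^12 restricted
to rad(b·m) ≤ 10^4 (b, m smooth: generate b as products of primes ≡ 1 mod 4 powers and m smooth,
test 4b − m² = □) and report max log b / rad(bm)^(2/3); a ratio growing along a family kills the
crux. Instrument row: the abc-harv E-tables restricted to curves with a 2-torsion point and Gaussian
two-division field (LMFDB label filter: torsion ≥ 2, disc < 0 square class) — fit of log|Δ| against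
N^(2/3). Not run this session (filed as the critic's first check).

NUMBERS. Record all E/ℚ: log|Δ_min| ≤ (1+o(1))·N log N-type, i.e. ε-shape exponent α = 1
(Murty–Pasten 2013; Pasten 2024). Frey class: α = 1/3 (Stewart–Yu 2001, `stewart_yu`). This line: α
= 2/3 on the Gaussian two-division class. One-parameter families: subexponential (Cuevas
Barrientos–Pasten 2025 Cor 1.2, `CuevasPasten2025_thm_1_1.cor_1_2`).

DEFINITION REQUESTS. None (the model is inlined as `⟨0, a, 0, b, 0⟩ : WeierstrassCurve ℚ`;
`GaussianInt` exists in Mathlib for the layer-2 stub). Cite fact wanted: Scoones arXiv:2111.07791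
Thm 3 + corollary over a number field K (constants depending on K; G over the Hilbert class field)
as a Literature named fact.

Novelty: Searches (2026-08-27): lit search --hybrid "Szpiro conjecture elliptic curve rational 2-torsion
point discriminant conductor bound linear forms in logarithms" (8 docs: Silverman 1994/2009,
Evertse–Győry 2015 p.91, Bombieri–Gubler p.418, Baker–Wüstholz p.147 — none on 2-torsion classes);
lit vsearch "abc/Szpiro inequality for curves with a point of order two via S-unit equations over
the two-torsion field" (8 docs, none relevant); lit galaxy search "Szpiro|2-torsion point" --star
pdf (8 hits, noise), "unit equation|Gaussian integers abc" --star pdf (6 hits: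
[galaxy:pdf:7635303352151822420] Pasten arXiv:2312.03566 on n²+1), "without rad(a)|abcd
conjecture|Sepulveda-Manzo" --star all (1 hit, noise); tree: rg SubexponentialSzpiroFamilies /
TernaryFreyCurvesSignatureNN2 (Bennett–Skinner Lemma 2.1 typed without conductor part).
Nearest prior art found: arXiv:2111.07791 (Scoones: the engine over K, no elliptic-curve
application); arXiv:2504.15971 Cor 1.2 (Cuevas Barrientos–Pasten: subexponential Szpiro in
one-parameter families by the modular method); arXiv:2312.03566 (Pasten: n² + 1 = the slice m = 2);
BennettSkinner2004 Lemma 2.1 (the same curves as Frey curves of signature (n,n,2), conductor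
formula); MurtyPasten2013 (all-E record).
Delta: nobody in the searched corpus runs the number-field Stewart–Yu machine over the FIXED
two-division field to push the Szpiro exponent below the all-E record on the two-parameter class of
curves with one rational 2-torsion point and Gaussian 2-di  [refs: 2312.03566, 2111.07791, 2504.15971, BennettSkinner2004, MurtyPasten2013]

Barriers (technique_class: linear-forms-in-logs, unit-equations, dictionary): - technique_class: linear-forms-in-logs, unit-equations, dictionary
- Literature.Barriers.ABC.BakerMethodBounds: INSIDE the Baker class and not beaten — the barrier
caps the method at bounds exponential in the radical; the line asks only an ε-shape (exponential)
bound with exponent 2/3 on a class, so it respects the cap; consequence stated plainly: this line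
can never reach A-PS or abc (FRONTIER-type class result).
- Literature.Barriers.ABC.SzpiroEpsilonCannotBeDropped: evaded — every statement carries `+ ε` in
the exponent and a free constant; no exact-exponent claim.
- Literature.Barriers.ABC.EpsilonCannotBeDropped: same — no ε-free abc form is asserted.
- B-LFL×DIVFIELD (planner barrier note, this session, NOTES.md §Barrier notes): the d-UNIFORM
version over varying two-division fields ℚ(√d) is blocked by the Pic⁰-volume (h_K R_K ≈ |d_K|^(1/2),
Brauer–Siegel) entering the heights of S-unit generators multiplicatively (factor ≥ N^(1/2) on top
of N^(2/3)); evaded here by FIXING K = ℚ(i) (class number 1, finite unit group).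
- Negatives index: 2 refuted statements (BelyiSqueeze polynomial-Belyi cruxes) — unrelated; nothing
here restates them.

sub-problem: ABC · status: draft · opened planner-abc-idea-1-g2-0 2026-08-27T23:12:46Z · rev 0 · ledger route-ABC-GaussianTwoDivision
GENERATED by the gate from the ledger (D-0016/17). Provers cite these decls: `theorem foo : Summit.ABC.ABC.Theses.GaussianTwoDivision.<Decl> := …` in Summits/ABC/ABC/Theorems/<Name>.lean.
-/

namespace Summit.ABC.ABC.Theses.GaussianTwoDivision

open scoped BigOperators Topology Manifold Classical MeasureTheory ProbabilityTheory Matrix InnerProductSpace ComplexConjugate ContinuousMap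
open Filter Set Function TopologicalSpace MeasureTheory

attribute [summit_statement] _root_.ABC

open Literature.Abc

/-- item stmt-ABC-23400 · target · rank 0 · open · by planner
why it might fail: only through the crux below; the class could also be too thin to be interesting (it is infinite and two-parameter: any coprime a ≡ m (mod 2), b = (a²+m²)/4).
sources: arXiv:2111.07791, StewartYu2001, MurtyPasten2013
[target] Szpiro ε-shape with exponent 2/3 on the Gaussian two-division class: for every ε > 0 there
is C with log|Δ_min(W)| ≤ C·N_W^(2/3+ε) for every elliptic W = ⟨0,a,0,b,0⟩ with gcd(a,b) = 1 and a²
+ m² = 4b, m ≠ 0. -/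
@[route_item "route-ABC-GaussianTwoDivision"]
def GaussianClassEpsShape : Prop :=
  ∀ ε : ℝ, 0 < ε → ∃ C : ℝ, ∀ a b m : ℤ, IsCoprime a b → m ≠ 0 → a ^ 2 + m ^ 2 = 4 * b → ∀ (W : WeierstrassCurve ℚ) [W.IsElliptic], W = ⟨0, (a : ℚ), 0, (b : ℚ), 0⟩ → Real.log (W.minimalDiscriminantNorm ℤ : ℝ) ≤ C * (W.conductorNorm ℤ : ℝ) ^ (2 / 3 + ε : ℝ)

/-- item stmt-ABC-23401 · crux · rank 2 · open · by planner
why it might fail: Scoones' G^(1/3+o(1)) corollary is printed over the Hilbert class field with her relabeling (2) and unit normalisation; if for K = ℚ(i) the triple (mi, e₋, −e₊) violates a side condition, or G counts split primes beyond rad(bm)², the exponent 2/3 degrades (to ≤ 1, not to nothing).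
sources: arXiv:2111.07791, StewartYu2001, EvertseGyory2015, doi:10.4064/aa123-1-2
[crux] GAUSSIAN NORM-FORM TRIPLE BOUND (ℤ-shadow of Stewart–Yu over ℚ(i)): for every ε > 0 there are
κ, c₀ such that for all integers a, b, m with gcd(a,b) = 1, m ≠ 0, a² + m² = 4b and b ≥ c₀: log b ≤
κ·rad(b·m)^(2/3+ε). The radical of a does not appear. [difficulty: L] -/
@[route_item "route-ABC-GaussianTwoDivision", crux]
def GaussianNormTripleBound : Prop :=
  ∀ ε : ℝ, 0 < ε → ∃ κ c₀ : ℝ, ∀ a b m : ℤ, IsCoprime a b → m ≠ 0 → a ^ 2 + m ^ 2 = 4 * b → c₀ ≤ (b : ℝ) → Real.log (b : ℝ) ≤ κ * (((UniqueFactorizationMonoid.radical (b * m)).natAbs : ℕ) : ℝ) ^ (2 / 3 + ε : ℝ)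

/-- item stmt-ABC-23402 · crux · rank 3 · open · by planner
why it might fail: it is abc itself outside a thin class — open; no claim; kept only as the honest complement of the conjunct this line attacks.
sources: Oesterle1988, MurtyPasten2013
[crux] DECLARED RESIDUAL (summit-strength, NOT claimed, exempt from T3/T4): abc given the class
theorem — i.e. abc off the Gaussian two-division class. Booked so that `closes` reaches the
Statement decl; to be narrowed to `SzpiroExponentBelowOne` off the class when that rung is a
registered closer. [deps: GaussianClassEpsShape] [difficulty: open-problem] -/
@[route_item "route-ABC-GaussianTwoDivision", crux]
def GaussianResidual : Prop :=
  Summit.ABC.ABC.Theses.GaussianTwoDivision.GaussianClassEpsShape → _root_.ABC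

/-- item stmt-ABC-23398 · support · rank 9 · closed · proved by Summit.ABC.ABC.Theorems.twoTorsionDictionary_proof (prover) · by planner
sources: Silverman2009, BennettSkinner2004
[support] TWO-TORSION DICTIONARY (Tate's algorithm away from 2): for coprime a, b with b(a² − 4b) ≠
0 and W = ⟨0,a,0,b,0⟩ elliptic, |Δ_min(W)| ≤ |16 b²(a² − 4b)| and rad(b(a² − 4b)) divides 2·N_W.
[difficulty: M] -/
@[route_item "route-ABC-GaussianTwoDivision", crux]
def TwoTorsionDictionary : Prop :=
  ∀ a b : ℤ, IsCoprime a b → b ≠ 0 → a ^ 2 - 4 * b ≠ 0 → ∀ (W : WeierstrassCurve ℚ) [W.IsElliptic], W = ⟨0, (a : ℚ), 0, (b : ℚ), 0⟩ → (W.minimalDiscriminantNorm ℤ : ℝ) ≤ |(16 : ℝ) * (b : ℝ) ^ 2 * ((a : ℝ) ^ 2 - 4 * (b : ℝ))| ∧ (UniqueFactorizationMonoid.radical (b * (a ^ 2 - 4 * b))).natAbs ∣ 2 * W.conductorNorm ℤ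

-- `TwoTorsionDictionary` holds: proved by `Summit.ABC.ABC.Theorems.twoTorsionDictionary_proof` (its module imports this route file, so no `_holds` link can be stated here).

/-- item stmt-ABC-23403 · support · rank 9 · closed · proved by Summit.ABC.ABC.Theorems.gaussianPayoff_proof (prover) · by planner
sources: Silverman2009
[support] PAYOFF GLUE: the triple bound and the dictionary give the class ε-shape (log|16 b² m²| ≤
log 64 + 3 log b since m² ≤ 4b; rad(bm) ≤ 2N; finitely many b < c₀ absorbed into C). [difficulty:
provable-now] -/
@[route_item "route-ABC-GaussianTwoDivision", crux]
def GaussianPayoff : Prop :=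
  Summit.ABC.ABC.Theses.GaussianTwoDivision.GaussianNormTripleBound → Summit.ABC.ABC.Theses.GaussianTwoDivision.TwoTorsionDictionary → Summit.ABC.ABC.Theses.GaussianTwoDivision.GaussianClassEpsShape

-- `GaussianPayoff` holds: proved by `Summit.ABC.ABC.Theorems.gaussianPayoff_proof` (its module imports this route file, so no `_holds` link can be stated here).

/-- item stmt-ABC-23404 · assembly · rank 1 · closed · proved by Summit.ABC.ABC.Theorems.gaussianTwoDivision_assembly_proof (prover) · by planner
sources: Oesterle1988
[assembly] GaussianNormTripleBound → TwoTorsionDictionary → GaussianPayoff → GaussianResidual → ABC. -/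
@[route_item "route-ABC-GaussianTwoDivision"]
def Assembly : Prop :=
  GaussianNormTripleBound → TwoTorsionDictionary → GaussianPayoff → GaussianResidual → _root_.ABC

-- `Assembly` holds: proved by `Summit.ABC.ABC.Theorems.gaussianTwoDivision_assembly_proof` (its module imports this route file, so no `_holds` link can be stated here).

/-! D-0027 §2.1 — DECIDING THEOREM (planner-authored via `route open/edit --closes-file`; by planner-abc-idea-1-g2-0 2026-08-27T23:12:46Z):
its hypotheses are this route's items and its conclusion the sub-problem Statement (glue_lint), and it elaborates with this file. -/

@[closes "route-ABC-GaussianTwoDivision"] theorem closes (h₁ : GaussianNormTripleBound) (h₂ : TwoTorsionDictionary) (h₃ : GaussianPayoff)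
    (h₄ : GaussianResidual) : _root_.ABC :=
  h₄ (h₃ h₁ h₂)

end Summit.ABC.ABC.Theses.GaussianTwoDivision
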